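import Literature.NumberTheory.LFunctions.KeiperPowerSeries
import Literature.NumberTheory.LFunctions.KeiperLiPositivityUpTo
import Literature.NumberTheory.LFunctions.FreitasLiHalfPlanesProofs
import Literature.NumberTheory.LFunctions.Voros2006OesterleProofs
import Literature.NumberTheory.LFunctions.RiemannHypothesisUpTo101
import HarnessLib

/-!
# Costume detectors III (LI: growth, height and arithmetic tails; typing guards) — cell `rh-split`

HONEST LABEL: «SPLITTING SEARCH over kernel-typed RH-EQUIVALENCES; a splitting A ∧ B ⟹ RH is CONDITIONAL
bookkeeping unless A and B are both proved; nothing here bears on the truth of RH.»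

Companion of `CostumeDetectors.lean` (§1 LI index tails: `rh_of_liTail`, `liTail_iff_rh`,
`rh_of_eventually_keiperLiCoeff_nonneg`, `li_bridge_iff`) and `CostumeDetectorsHeight.lean`.  NEGATIVE KNOWLEDGE
for future planners (brief `RH-SPLITTING-BRIEF.md` sha16 f79c5f09d8bcb036; cards SPLIT-li-neg / SPLIT-li-finite /
SPLIT-li-bridge): in the LI family every correctly typed infinite conjunct — the GROWTH tail (`λ_n` bounded below,
`λ_n ≥ 0` eventually), the HEIGHT tail (the zero-sum of `λ_n` restricted to zeros above `H` is `≥ 0`), the ARITHMETIC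
tails on Coffey's oscillatory part `S₂(n) = liOscPart n` (linear lower bound, `o(n)`), Coffey's Conjecture 2 — is RH
BY ITSELF, F1-free (standard axioms); the only cheap refutations in the family bite MIS-TYPINGS (`∀ n, λ_n ≥ 0`
including the junk index `n = 0`, `λ₀ = −log 2 < 0`) or OVER-STRENGTHENINGS (Freitas shifts `τ < 1`); and the FIN
side `λ_n ≥ 0, n ≤ 609` is a kernel theorem from RH to height `101`.  The last section is CONDITIONAL(F1) (Platt–
Trudgian named fact, NOT discharged): read it as `F1 → (TAIL ↔ RH)`.  Raw quantified forms only (no `def`).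
Typed by rh-split-li-neg, replayed and filed by rh-split-typer-1, refereed by rh-split-ref.  Inside this namespace
the bare token `RiemannHypothesis` is `Summit.RiemannHypothesis`; Mathlib's is `_root_.RiemannHypothesis`.
-/

noncomputable section

-- D-0017: `Summit.<S>.<S>.…` is the designed namespace of a single-problem summit.
set_option linter.dupNamespace false

open Complex Filter Topology Set
open scoped ComplexConjugate

namespace Summit.RiemannHypothesis.RiemannHypothesis.Theorems.Splittings.CostumeDetectorsLi

open Literature.NumberTheory.LFunctions Literature.NumberTheory.DiophantineGeometry

/-! ### LI — growth tails (Bombieri–Lagarias 1999 Thm 1 (c)⇒(a), tree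
`riemannHypothesis_of_keiperLiCoeff_bddBelow`; `li_criterion_holds`) -/

/-- **LI, growth tail.** `(∃ K, ∀ n ≥ 1, −K ≤ λ_n) ↔ RH`: boundedness below of Li's coefficients is
already RH [cite: BombieriLagarias1999, Theorem 1 (c)⇒(a)]; tree `riemannHypothesis_of_keiperLiCoeff_bddBelow`,
`li_criterion_holds`.  F1-free. -/
theorem liBddBelow_iff_rh :
    (∃ K : ℝ, ∀ n : ℕ, 1 ≤ n → -K ≤ keiperLiCoeff n) ↔ _root_.RiemannHypothesis := by
  constructor
  · rintro ⟨K, hK⟩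
    exact riemannHypothesis_of_keiperLiCoeff_bddBelow hK
  · intro hRH
    exact ⟨0, fun n hn ↦ by simpa using (li_criterion_holds.1 hRH) n hn⟩

/-- **LI, eventual tail.** `(∀ᶠ n, 0 ≤ λ_n) ↔ RH` (finitely many exceptions are bounded below for free).
F1-free. -/
theorem liEventually_iff_rh : (∀ᶠ n : ℕ in atTop, 0 ≤ keiperLiCoeff n) ↔ _root_.RiemannHypothesis := by
  constructor
  · intro h
    obtain ⟨N, hN⟩ := eventually_atTop.1 h
    set K : ℝ := ∑ m ∈ Finset.range (N + 1), |keiperLiCoeff m| with hK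
    refine riemannHypothesis_of_keiperLiCoeff_bddBelow (K := K) fun n _ ↦ ?_
    by_cases hn : N < n
    · have hK0 : 0 ≤ K := Finset.sum_nonneg fun m _ ↦ abs_nonneg _
      linarith [hN n hn.le]
    · have hmem : n ∈ Finset.range (N + 1) := Finset.mem_range.2 (by omega)
      have hle : |keiperLiCoeff n| ≤ K :=
        Finset.single_le_sum (f := fun m ↦ |keiperLiCoeff m|) (fun m _ ↦ abs_nonneg _) hmem
      linarith [neg_abs_le (keiperLiCoeff n)]
  · intro hRH
    exact eventually_atTop.2 ⟨1, li_criterion_holds.1 hRH⟩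

/-! ### LI — the HEIGHT tail is `RH above H` in costume (Bombieri–Lagarias Thm 1 is multiset-level:
tree `bombieriLagarias1999_theorem1_pos` applied to the sub-family of zeros with `|Im ρ| > H`) -/

/-- Cast bookkeeping: the `toNat` of a zero multiplicity, cast to `ℝ`, is the multiplicity. [folklore] -/
private theorem li_toNat_cast_eq (ρ : ℂ) (h : ρ ∈ ZetaZeros.riemannZetaNontrivialZeros) :
    (((riemannZetaZeroOrder ρ).toNat : ℕ) : ℝ) = (riemannZetaZeroOrder ρ : ℝ) := by
  have h1 := ZetaZeros.riemannZetaNontrivialZeros.one_le_order h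
  have : ((riemannZetaZeroOrder ρ).toNat : ℤ) = riemannZetaZeroOrder ρ := Int.toNat_of_nonneg (by omega)
  exact_mod_cast this

/-- A non-trivial zero of `ζ` is not `0`. [folklore] -/
private theorem li_ne_zero_of_mem {ρ : ℂ} (h : ρ ∈ ZetaZeros.riemannZetaNontrivialZeros) : ρ ≠ 0 := by
  intro h0
  have := ZetaZeros.riemannZetaNontrivialZeros.re_pos h
  rw [h0] at this
  simp at this

/-- **LI, height tail ≡ RH-above-H.** For every real `H`: «the zeros with `|Im ρ| > H` contribute
non-negatively to Li's zero sum for every `n ≥ 1`», i.e.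
`∀ n ≥ 1, 0 ≤ Σ'_{|Im ρ|>H} m(ρ)·Re[1 − (1 − 1/ρ)ⁿ]` (the typing of `keiperLiCoeff_eq_tsum_zeros`), is
EQUIVALENT to «every non-trivial zero with `|Im ρ| > H` has real part 1/2» [cite: BombieriLagarias1999,
Theorem 1, multiset-level; Li2004, Theorem 2]; tree `bombieriLagarias1999_theorem1_pos`,
`summable_weight_zetaZeros`.  So the height split `RH(≤H) ∧ [Li sum above H ≥ 0]` is the partition
`RH(≤H) ∧ RH(>H)` re-lettered.  F1-free. -/
theorem liZeroTailAbove_iff_rhAbove (H : ℝ) :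
    (∀ n : ℕ, 1 ≤ n → 0 ≤ ∑' ρ : {ρ : ℂ // ρ ∈ ZetaZeros.riemannZetaNontrivialZeros ∧ H < |ρ.im|},
        (riemannZetaZeroOrder (ρ : ℂ) : ℝ) * (1 - (1 - 1 / (ρ : ℂ)) ^ n).re)
      ↔ (∀ ρ ∈ ZetaZeros.riemannZetaNontrivialZeros, H < |ρ.im| → ρ.re = 1 / 2) := by
  classical
  let incl : {ρ : ℂ // ρ ∈ ZetaZeros.riemannZetaNontrivialZeros ∧ H < |ρ.im|} →
      ZetaZeros.riemannZetaNontrivialZeros := fun ρ ↦ ⟨(ρ : ℂ), ρ.2.1⟩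
  have hinj : Function.Injective incl := by
    intro a b hab
    apply Subtype.ext
    have := congrArg (fun x : ZetaZeros.riemannZetaNontrivialZeros ↦ (x : ℂ)) hab
    simpa [incl] using this
  have hR : Summable (BombieriLagarias.weight
      (fun ρ : {ρ : ℂ // ρ ∈ ZetaZeros.riemannZetaNontrivialZeros ∧ H < |ρ.im|} ↦ 1 - conj (ρ : ℂ))
      (fun ρ ↦ (riemannZetaZeroOrder (ρ : ℂ)).toNat)) := by
    have h := summable_weight_zetaZeros.comp_injective hinj
    refine h.congr fun ρ ↦ ?_
    simp [Function.comp, incl, BombieriLagarias.weight]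
  have hBL := bombieriLagarias1999_theorem1_pos
    (fun ρ : {ρ : ℂ // ρ ∈ ZetaZeros.riemannZetaNontrivialZeros ∧ H < |ρ.im|} ↦ (ρ : ℂ))
    (fun ρ ↦ (riemannZetaZeroOrder (ρ : ℂ)).toNat)
    (fun ρ ↦ by have := ZetaZeros.riemannZetaNontrivialZeros.one_le_order ρ.2.1; omega)
    (fun ρ ↦ li_ne_zero_of_mem ρ.2.1) (fun ρ ↦ ZetaZeros.riemannZetaNontrivialZeros.ne_one ρ.2.1) hR
  have hBL' : (∀ ρ : {ρ : ℂ // ρ ∈ ZetaZeros.riemannZetaNontrivialZeros ∧ H < |ρ.im|}, 1 / 2 ≤ (ρ : ℂ).re)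
      ↔ (∀ n : ℕ, 1 ≤ n → 0 ≤ ∑' ρ : {ρ : ℂ // ρ ∈ ZetaZeros.riemannZetaNontrivialZeros ∧ H < |ρ.im|},
        (riemannZetaZeroOrder (ρ : ℂ) : ℝ) * (1 - (1 - 1 / (ρ : ℂ)) ^ n).re) := by
    rw [hBL]
    refine forall_congr' fun n ↦ forall_congr' fun _ ↦ ?_
    rw [tsum_congr fun ρ ↦ by rw [li_toNat_cast_eq (ρ : ℂ) ρ.2.1]]
  rw [← hBL']
  constructor
  · intro h ρ hρ hH
    have hge := h ⟨ρ, hρ, hH⟩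
    have hmem' : 1 - conj ρ ∈ ZetaZeros.riemannZetaNontrivialZeros ∧ H < |(1 - conj ρ).im| := by
      refine ⟨ZetaZeros.riemannZetaNontrivialZeros.one_sub_conj_mem hρ, ?_⟩
      simpa [sub_im, one_im, Complex.conj_im] using hH
    have hle := h ⟨1 - conj ρ, hmem'⟩
    simp only [sub_re, one_re, Complex.conj_re] at hle
    simp only at hge
    linarith
  · intro h ρ
    rw [h (ρ : ℂ) ρ.2.1 ρ.2.2]

/-- `RH(≤H) ∧ RH(>H) → RH` — the partition glue (conjugation handles `Im < 0`).  F1-free. -/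
theorem rh_of_rhUpTo_of_rhAbove {H : ℝ} (hA : RiemannHypothesisUpTo H)
    (hB : ∀ ρ ∈ ZetaZeros.riemannZetaNontrivialZeros, H < |ρ.im| → ρ.re = 1 / 2) :
    _root_.RiemannHypothesis := by
  intro s hs htriv _
  have hmem : s ∈ ZetaZeros.riemannZetaNontrivialZeros := by
    refine ⟨hs, ?_⟩
    rintro ⟨k, hk⟩
    exact htriv ⟨k, hk.symm⟩
  by_cases hH : H < |s.im|
  · exact hB s hmem hH
  · rw [not_lt] at hH
    have him := ZetaZeros.riemannZetaNontrivialZeros.im_ne_zero hmem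
    rcases lt_or_gt_of_ne him with hneg | hpos
    · have hmem' := ZetaZeros.riemannZetaNontrivialZeros.conj_mem hmem
      have hz' := ZetaZeros.riemannZetaNontrivialZeros.zeta_eq_zero hmem'
      have h1 : 0 < (conj s).im := by simp; linarith
      have h2 : (conj s).im ≤ H := by
        simp only [Complex.conj_im]
        have : |s.im| = -s.im := abs_of_neg hneg
        linarith
      have := hA (conj s) hz' h1 h2
      simpa using this
    · have h2 : s.im ≤ H := by
        have : |s.im| = s.im := abs_of_pos hpos
        linarith
      exact hA s hs hpos h2

/-- **LI, the height splitting PROVED and RELABELLED.** `RH(≤H) ∧ [Li zero-sum above H ≥ 0 ∀ n ≥ 1] → RH`;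
by `liZeroTailAbove_iff_rhAbove` the second conjunct is `RH(>H)`.  F1-free. -/
theorem rh_of_rhUpTo_of_liZeroTailAbove {H : ℝ} (hA : RiemannHypothesisUpTo H)
    (hB : ∀ n : ℕ, 1 ≤ n → 0 ≤ ∑' ρ : {ρ : ℂ // ρ ∈ ZetaZeros.riemannZetaNontrivialZeros ∧ H < |ρ.im|},
        (riemannZetaZeroOrder (ρ : ℂ) : ℝ) * (1 - (1 - 1 / (ρ : ℂ)) ^ n).re) :
    _root_.RiemannHypothesis :=
  rh_of_rhUpTo_of_rhAbove hA ((liZeroTailAbove_iff_rhAbove H).1 hB)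

/-- **LI, height tail given FIN(H) is RH** (the TAIL LEMMA instance for the height split; generic `H`).
F1-free as an implication from `RiemannHypothesisUpTo H`. -/
theorem liZeroTailAbove_iff_rh_of_rhUpTo {H : ℝ} (hA : RiemannHypothesisUpTo H) :
    (∀ n : ℕ, 1 ≤ n → 0 ≤ ∑' ρ : {ρ : ℂ // ρ ∈ ZetaZeros.riemannZetaNontrivialZeros ∧ H < |ρ.im|},
        (riemannZetaZeroOrder (ρ : ℂ) : ℝ) * (1 - (1 - 1 / (ρ : ℂ)) ^ n).re)
      ↔ _root_.RiemannHypothesis := by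
  refine ⟨rh_of_rhUpTo_of_liZeroTailAbove hA, fun hRH ↦ (liZeroTailAbove_iff_rhAbove H).2 ?_⟩
  intro ρ hρ _
  exact hRH ρ (ZetaZeros.riemannZetaNontrivialZeros.zeta_eq_zero hρ)
    (fun ⟨k, hk⟩ ↦ hρ.2 ⟨k, hk.symm⟩) (ZetaZeros.riemannZetaNontrivialZeros.ne_one hρ)

/-! ### LI — ARITHMETIC tails on Coffey's `S₂(n) = liOscPart n` (`λ_n = liTrend n + liOscPart n`,
tree `Coffey2005_thm1_holds`; trend law `abs_liTrend_sub_mainTerm_le` is a THEOREM) -/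

/-- **LI, weakest arithmetic tail.** An eventual one-sided LINEAR lower bound on Coffey's oscillating
part, `∃ K, ∀ᶠ n, −K·n ≤ S₂(n)`, is EQUIVALENT to RH: `⟹` since `λ_n ≥ ½n(log n − 1 + γ − log 2π) −
(1 + 2/π) − K n ≥ 0` eventually and eventual non-negativity is RH (Bombieri–Lagarias (c)⇒(a));
`⟸` since RH gives `S₂(n) = o(n)` [cite: Voros2006, §4 (SLN); Coffey2005, Theorem 1]; tree
`abs_liTrend_sub_mainTerm_le`, `Coffey2005_thm1_holds`, `isLittleO_liOscPart_of_onlyif`,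
`Voros2006_thm_onlyif_holds`.  F1-free. -/
theorem liOscLinearLower_iff_rh :
    (∃ K : ℝ, ∀ᶠ n : ℕ in atTop, -K * (n : ℝ) ≤ liOscPart n) ↔ _root_.RiemannHypothesis := by
  constructor
  · rintro ⟨K, hK⟩
    apply liEventually_iff_rh.1
    have hlog : Tendsto (fun n : ℕ ↦ Real.log (n : ℝ)) atTop atTop :=
      Real.tendsto_log_atTop.comp (tendsto_natCast_atTop_atTop (R := ℝ))
    have hev := hlog.eventually_ge_atTop
      (1 - Real.eulerMascheroniConstant + Real.log (2 * Real.pi) + 2 * K + 2 * (1 + 2 / Real.pi))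
    filter_upwards [hK, hev, eventually_ge_atTop 1] with n hKn hlogn hn1
    have ht := abs_liTrend_sub_mainTerm_le hn1
    rw [abs_le] at ht
    have ht1 : (n : ℝ) / 2 * (Real.log n - 1 + Real.eulerMascheroniConstant - Real.log (2 * Real.pi))
        - (1 + 2 / Real.pi) ≤ liTrend n := by linarith [ht.1]
    have hn : (1 : ℝ) ≤ n := by exact_mod_cast hn1
    have hπ : (0 : ℝ) ≤ 1 + 2 / Real.pi := by positivity
    have hc : 2 * K + 2 * (1 + 2 / Real.pi) ≤
        Real.log n - 1 + Real.eulerMascheroniConstant - Real.log (2 * Real.pi) := by linarith [hlogn]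
    have h1 : K * n + (1 + 2 / Real.pi) * n ≤
        (n : ℝ) / 2 * (Real.log n - 1 + Real.eulerMascheroniConstant - Real.log (2 * Real.pi)) :=
      calc K * n + (1 + 2 / Real.pi) * n = (n : ℝ) / 2 * (2 * K + 2 * (1 + 2 / Real.pi)) := by ring
        _ ≤ (n : ℝ) / 2 * (Real.log n - 1 + Real.eulerMascheroniConstant - Real.log (2 * Real.pi)) :=
          mul_le_mul_of_nonneg_left hc (by positivity)
    have h2 : (1 + 2 / Real.pi) ≤ (1 + 2 / Real.pi) * n := le_mul_of_one_le_right hπ hn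
    have heq : keiperLiCoeff n = liTrend n + liOscPart n := (Coffey2005_thm1_holds).2 n hn1
    linarith [ht1, h1, h2, hKn, heq]
  · intro hRH
    refine ⟨1, ?_⟩
    have hb := (isLittleO_liOscPart_of_onlyif Voros2006_thm_onlyif_holds hRH).bound
      (show (0 : ℝ) < 1 by norm_num)
    filter_upwards [hb] with n hn
    rw [Real.norm_eq_abs, Real.norm_eq_abs, one_mul, Nat.abs_cast] at hn
    have := neg_abs_le (liOscPart n)
    linarith

/-- **LI, arithmetic tail `S₂(n) = o(n)` ↔ RH** [cite: Voros2006, §4 (SLN) ⟸; BombieriLagarias1999,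
Theorem 1 ⟹].  F1-free. -/
theorem liOscLittleO_iff_rh :
    ((fun n : ℕ ↦ liOscPart n) =o[atTop] (fun n : ℕ ↦ (n : ℝ))) ↔ _root_.RiemannHypothesis := by
  constructor
  · intro h
    apply liOscLinearLower_iff_rh.1
    refine ⟨1, ?_⟩
    have hb := h.bound (show (0 : ℝ) < 1 by norm_num)
    filter_upwards [hb] with n hn
    rw [Real.norm_eq_abs, Real.norm_eq_abs, one_mul, Nat.abs_cast] at hn
    have := neg_abs_le (liOscPart n)
    linarith
  · intro hRH
    exact isLittleO_liOscPart_of_onlyif Voros2006_thm_onlyif_holds hRH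

/-- **LI, Coffey 2005 Conjecture 2** (`|S₂(n)| ≤ 3γ + C₂ n^{1/2+ε}`, eq. (53), arXiv:math-ph/0505052 p.6)
for any one exponent with `ε ≤ 1/2` ALONE implies RH — the trend conjunct of the arithmetic split is a
theorem, so this `B` is RH-strength (RH ⟹ `S₂(n) = O(√n log n)` is [cite: Lagarias2007LiCoefficients, Theorem 6.1],
in print, not in the tree).  F1-free. -/
theorem rh_of_coffeyConj2 {ε : ℝ} (hε : ε ≤ 1 / 2)
    (h : ∃ C : ℝ, ∀ n : ℕ, 1 ≤ n →
      |liOscPart n| ≤ 3 * Real.eulerMascheroniConstant + C * (n : ℝ) ^ (1 / 2 + ε)) :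
    _root_.RiemannHypothesis := by
  obtain ⟨C, hC⟩ := h
  apply liOscLinearLower_iff_rh.1
  refine ⟨3 * Real.eulerMascheroniConstant + |C|, ?_⟩
  filter_upwards [eventually_ge_atTop 1] with n hn1
  have hn : (1 : ℝ) ≤ n := by exact_mod_cast hn1
  have hγ : 0 ≤ Real.eulerMascheroniConstant :=
    le_of_lt (lt_trans one_half_pos Real.one_half_lt_eulerMascheroniConstant)
  have hpow : (n : ℝ) ^ (1 / 2 + ε) ≤ n := by
    calc (n : ℝ) ^ (1 / 2 + ε) ≤ (n : ℝ) ^ (1 : ℝ) := Real.rpow_le_rpow_of_exponent_le hn (by linarith)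
      _ = n := Real.rpow_one _
  have hpow0 : 0 ≤ (n : ℝ) ^ (1 / 2 + ε) := Real.rpow_nonneg (by positivity) _
  have h1 := hC n hn1
  have h2 : C * (n : ℝ) ^ (1 / 2 + ε) ≤ |C| * n := by
    calc C * (n : ℝ) ^ (1 / 2 + ε) ≤ |C| * (n : ℝ) ^ (1 / 2 + ε) :=
          mul_le_mul_of_nonneg_right (le_abs_self C) hpow0
      _ ≤ |C| * n := mul_le_mul_of_nonneg_left hpow (abs_nonneg C)
  have h3 : 3 * Real.eulerMascheroniConstant ≤ 3 * Real.eulerMascheroniConstant * n :=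
    le_mul_of_one_le_right (by positivity) hn
  have h4 := neg_abs_le (liOscPart n)
  have h5 : -(3 * Real.eulerMascheroniConstant + |C|) * (n : ℝ)
      = -(3 * Real.eulerMascheroniConstant * n) - |C| * n := by ring
  rw [h5]
  linarith

/-! ### LI — the FIN side is a THEOREM, F1-free, in kernel (so the index split is «A theorem ∧ B ≡ RH») -/

/-- **LI, FIN side F1-FREE in pure kernel (standard axioms).** `λ_n ≥ 0` for every `1 ≤ n ≤ 609`, from the
tree's kernel theorem `riemannHypothesisUpTo_hundredOne` (RH up to height 101, no numerical hypothesis, no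
`native_decide`) and Brown's sub-range theorem `keiperLiCoeff_nonneg_of_riemannHypothesisUpTo`
(`n ≤ 2π(T − 4)`) [cite: BrownLiCriterion2005, Thm. 2 (sub-range)].  Hence the index splitting
`FIN(609) ∧ TAIL(609) → RH` has `A` a THEOREM and `B ↔ RH` (`liTail_iff_rh 609`): RELABELLING, not a
splitting.  F1-free. -/
theorem keiperLiCoeff_nonneg_of_le_609 {n : ℕ} (hn : 1 ≤ n) (hn' : n ≤ 609) :
    0 ≤ keiperLiCoeff n := by
  refine keiperLiCoeff_nonneg_of_riemannHypothesisUpTo riemannHypothesisUpTo_hundredOne hn ?_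
  have h : (n : ℝ) ≤ 609 := by exact_mod_cast hn'
  have hπ := Real.pi_gt_d2
  nlinarith

/-! ### LI — cheap refutations that DO bite (typing traps / over-strengthenings only) -/

/-- **LI, typing trap.** The UNGUARDED tail `∀ n, 0 ≤ λ_n` is FALSE: `λ_0 = Re log ξ(1) = log ½ < 0`
(junk index; tree docstring of `keiperLiCoeff`, `riemannXi_one`).  Every Li tail must carry `1 ≤ n`. -/
theorem not_forall_keiperLiCoeff_nonneg : ¬ ∀ n : ℕ, 0 ≤ keiperLiCoeff n := by
  intro h
  have h0 : keiperLiCoeff 0 = Real.log (1 / 2) := by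
    simp only [keiperLiCoeff, Nat.zero_sub, pow_zero, one_mul, Nat.factorial_zero, Nat.cast_one,
      div_one, iteratedDeriv_zero, riemannXi_one]
    have : (1 / 2 : ℂ) = ((1 / 2 : ℝ) : ℂ) := by push_cast; ring
    rw [this, Complex.log_ofReal_re]
  have hneg : keiperLiCoeff 0 < 0 := by
    rw [h0]; exact Real.log_neg (by norm_num) (by norm_num)
  exact absurd (h 0) (not_le.2 hneg)

/-- **LI, over-strengthened shift REFUTED.** For `1/2 ≤ τ < 1` the shifted Li positivity
`∀ n ≥ 1, α_n(τ) ≥ 0` (Freitas' `freitasAlpha`; `α_n(1) = λ_n`) is FALSE: it would make `Re s > τ/2`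
zero-free [cite: Freitas2006, Corollary 4.2; arXiv:math/0507368 p.8], tree `Freitas2006_cor_4_2_holds`,
but a non-trivial zero `ρ` exists (`riemannZetaNontrivialZeros_infinite`) and `ρ` or `1 − ρ̄` has real
part `≥ 1/2 > τ/2`.  F1-free. -/
theorem not_forall_freitasAlpha_nonneg_of_lt_one {τ : ℝ} (h1 : 1 / 2 ≤ τ) (h2 : τ < 1) :
    ¬ ∀ n : ℕ, 1 ≤ n → 0 ≤ freitasAlpha τ n := by
  intro hpos
  have hnz : ¬ (∀ s : ℂ, τ / 2 < s.re → riemannZeta s ≠ 0) := by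
    intro hzf
    obtain ⟨ρ, hρ⟩ := riemannZetaNontrivialZeros_infinite.nonempty
    by_cases hre : 1 / 2 ≤ ρ.re
    · exact hzf ρ (by linarith) (ZetaZeros.riemannZetaNontrivialZeros.zeta_eq_zero hρ)
    · have hρ' := ZetaZeros.riemannZetaNontrivialZeros.one_sub_conj_mem hρ
      refine hzf (1 - conj ρ) ?_ (ZetaZeros.riemannZetaNontrivialZeros.zeta_eq_zero hρ')
      simp only [sub_re, one_re, Complex.conj_re]
      linarith
  obtain ⟨n', _, hn'⟩ := Freitas2006_cor_4_2_holds τ h1 (by linarith) hnz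
  obtain ⟨hk1, hk⟩ := hn' 0
  exact absurd (hpos (n' 0) hk1) (not_le.2 hk)

/-! ### CONDITIONAL(F1) — at the Platt–Trudgian height (named numerical hypothesis
`riemannHypothesisUpTo_platt_trudgian`, Bull. LMS 53 (2021) Thm 1; never discharged here) -/

/-- **LI, height tail at `H₀ = 3 000 175 332 800` ↔ RH, CONDITIONAL on F1.** -/
theorem liZeroTailAbovePlattTrudgian_iff_rh_of_F1 (hF1 : riemannHypothesisUpTo_platt_trudgian) :
    (∀ n : ℕ, 1 ≤ n → 0 ≤ ∑' ρ : {ρ : ℂ // ρ ∈ ZetaZeros.riemannZetaNontrivialZeros ∧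
        (3000175332800 : ℝ) < |ρ.im|},
        (riemannZetaZeroOrder (ρ : ℂ) : ℝ) * (1 - (1 - 1 / (ρ : ℂ)) ^ n).re)
      ↔ _root_.RiemannHypothesis :=
  liZeroTailAbove_iff_rh_of_rhUpTo hF1

end Summit.RiemannHypothesis.RiemannHypothesis.Theorems.Splittings.CostumeDetectorsLi

end
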